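import Mathlib
import HarnessLib
import Summits.PneNP.PneNP.Theorems.AeaCutRectanglesTransversalEngine

/-!
# Route AeaCutRectangles — the TOFT UNIT SYSTEM `𝒯_L` and its D2 colouring
# (file 2 of 4 of the BC5 rung of the deciding crux `FoolingMeasure`, stmt-PneNP-19727)

The unit system on `Vx L = Fin 10 × Fin L` (`L` odd, `≥ 3`; blocks `0 = a` (odd cycle `A`), `1 = d` (odd cycle
`D`), `2 = b`, `3 = b'`, `4,5 = p_b, p'_b` (diamond apexes forcing `col bᵢ = col b'ᵢ`), `6 = c`, `7 = c'`,
`8,9 = p_c, p'_c`): the frame `frame L` (cycles, matchings `aᵢbᵢ`, `dⱼcⱼ`, diamonds), the `L²` units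
`unit L (i,j) = {bᵢcⱼ, b'ᵢc'ⱼ}`, the cut `cut L` = blocks `1,3,4,7,8` (`5L` of the `10L` vertices, splitting every
unit), and **D2** (`toft_D2`): for every unit `u0`, `gammaMinus (frame L) (unit L) u0` is 3-colourable, by the
explicit colouring `col u0` (the `K_(L,L)`-type edges of Toft's graph are critical).  `Fin 3` pigeonhole lemmas
and the odd-cycle lemma `odd_cycle` used by D1 (file 3) are proved here too.

HONEST FRAMING: elementary finite combinatorics (Toft 1970-type critical graphs, a hybrid/fooling argument,
bookkeeping of an explicit measure); FRONTIER material for a rung of Fagin's complement ladder (NON-3-COL vs.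
ESO(∀∃∀, arity 2)); nothing here bears on P vs NP, and the summit stays where it was.

Sources: programme archive 2001, pnp/generalized-spectra-complement/work/aea/AEA.md Def. 4.1, Thm. 4.2, Prop. 5.1,
§6; blind-check records bc-aea-rectangles (B)(D), bc-aea-cut37; B. Toft, "On the maximal number of edges of
critical k-chromatic graphs", Studia Sci. Math. Hungar. 5 (1970) 461–470 (the dense 4-critical graphs).
-/

set_option linter.dupNamespace false -- `Summit.PneNP.PneNP.…`: summit = sub-problem name (D-0017 single-conjunct layout)

namespace Summit.PneNP.PneNP.Theorems.AeaCutRectanglesFixedCutFooling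

open Finset
open Summit.PneNP.PneNP.Theorems.AeaCutRectanglesTransversalEngine

/-! ### `Fin 3` bookkeeping and the odd cycle -/

/-- Pigeonhole on `Fin 3`: three values avoiding `x` cannot be pairwise distinct. -/
theorem fin3_cases (x a b c : Fin 3) : a = x ∨ b = x ∨ c = x ∨ a = b ∨ c = a ∨ c = b := by
  revert x a b c
  decide

/-- Pigeonhole on `Fin 3`, four-value form used for the diamonds. -/
theorem fin3_third_cases (x y z w : Fin 3) : x = y ∨ x = z ∨ y = z ∨ w = y ∨ w = z ∨ w = x := by
  revert x y z w
  decide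

/-- Pigeonhole on `Fin 3`, diamond form: apexes `p ≠ q` force the two tips to agree. -/
theorem fin3_diamond_cases (a b p q : Fin 3) : p = q ∨ a = p ∨ a = q ∨ b = p ∨ b = q ∨ a = b := by
  revert a b p q
  decide

/-- Successor modulo `L` on `Fin L` (the cycle step). -/
def succMod {L : ℕ} (i : Fin L) : Fin L := ⟨(i.val + 1) % L, Nat.mod_lt _ i.pos⟩

/-- Value of the cyclic successor away from the wrap-around. -/
theorem succMod_val_of_lt {L : ℕ} (i : Fin L) (h : i.val + 1 < L) : (succMod i).val = i.val + 1 := by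
  simp [succMod, Nat.mod_eq_of_lt h]

/-- Value of the cyclic successor at the wrap-around. -/
theorem succMod_val_of_eq {L : ℕ} (i : Fin L) (h : i.val + 1 = L) : (succMod i).val = 0 := by
  simp [succMod, h]

/-- The two cases for the value of the cyclic successor. -/
theorem succMod_val_cases {L : ℕ} (i : Fin L) :
    ((succMod i).val = i.val + 1 ∧ i.val + 1 < L) ∨ ((succMod i).val = 0 ∧ i.val + 1 = L) := by
  by_cases h : i.val + 1 < L
  · exact Or.inl ⟨succMod_val_of_lt i h, h⟩
  · have h' : i.val + 1 = L := by have := i.isLt; omega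
    exact Or.inr ⟨succMod_val_of_eq i h', h'⟩

/-- The cyclic successor moves every point once `L ≥ 2`. -/
theorem succMod_ne_self {L : ℕ} (hL : 2 ≤ L) (i : Fin L) : succMod i ≠ i := by
  intro h
  have h1 := congrArg Fin.val h
  rcases succMod_val_cases i with ⟨h2, h3⟩ | ⟨h2, h3⟩ <;> omega

/-- **Odd cycles**: a proper colouring of the `L`-cycle by `Fin 3` cannot avoid a colour when `L` is odd. -/
theorem odd_cycle {L : ℕ} (hL : Odd L) (f : Fin L → Fin 3) (x : Fin 3) (hx : ∀ i, f i ≠ x)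
    (hadj : ∀ i, f i ≠ f (succMod i)) : False := by
  obtain ⟨m, hm⟩ := hL
  have h0L : 0 < L := by omega
  have key : ∀ k (hk : k < L), (f ⟨k, hk⟩ = f ⟨0, h0L⟩ ↔ Even k) := by
    intro k
    induction k with
    | zero =>
      intro hk
      simp
    | succ k ih =>
      intro hk
      have hk' : k < L := by omega
      have hs : succMod ⟨k, hk'⟩ = ⟨k + 1, hk⟩ := Fin.ext (succMod_val_of_lt _ hk)
      have hne := hadj ⟨k, hk'⟩
      rw [hs] at hne
      rw [Nat.even_add_one, ← ih hk']
      constructor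
      · intro h1 h2
        exact hne (h2.trans h1.symm)
      · intro h
        rcases fin3_cases x (f ⟨0, h0L⟩) (f ⟨k, hk'⟩) (f ⟨k + 1, hk⟩) with h' | h' | h' | h' | h' | h'
        · exact (hx _ h').elim
        · exact (hx _ h').elim
        · exact (hx _ h').elim
        · exact (h h'.symm).elim
        · exact h'
        · exact (hne h'.symm).elim
  have hlast : succMod (⟨L - 1, by omega⟩ : Fin L) = ⟨0, h0L⟩ :=
    Fin.ext (succMod_val_of_eq _ (by show L - 1 + 1 = L; omega))
  have hne := hadj ⟨L - 1, by omega⟩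
  rw [hlast] at hne
  exact hne ((key (L - 1) (by omega)).2 ⟨m, by omega⟩)

/-! ### The Toft unit system `𝒯_L`

Vertices `Fin 10 × Fin L`: block `0` = odd cycle `A`, `1` = odd cycle `D`, `2` = `b`, `3` = `b'`, `4`,`5` = the
diamond apexes of `b`, `6` = `c`, `7` = `c'`, `8`,`9` = the diamond apexes of `c`.  Frame: the two cycles, the
matchings `aᵢbᵢ`, `dⱼcⱼ`, and the diamonds forcing `col bᵢ = col b'ᵢ`, `col cⱼ = col c'ⱼ`.  Units: `π_{ij} =
{bᵢcⱼ, b'ᵢc'ⱼ}` — every transversal graph contracts onto Toft's 4-critical graph (odd cycle — matching —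
`K_{L,L}` — matching — odd cycle), whose `K_{L,L}` edges are all critical.  Cut: `B₀ = D ∪ b' ∪ p_b ∪ c' ∪ p_c`
(`5L` of the `10L` vertices); EVERY unit is split by `B₀`, so the engine gives rectangle mass `≤ 2^{-L²}`. -/

/-- The vertex type of `𝒯_L`. -/
abbrev Vx (L : ℕ) := Fin 10 × Fin L

/-- The vertex of block `k` and index `i`. -/
def vx {L : ℕ} (k : Fin 10) (i : Fin L) : Vx L := (k, i)

/-- `vx` is injective in both arguments. -/
@[simp] theorem vx_inj {L : ℕ} {k k' : Fin 10} {i i' : Fin L} : vx k i = vx k' i' ↔ k = k' ∧ i = i' :=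
  Prod.mk.injEq _ _ _ _ |>.to_iff

/-- Block index of `vx`. -/
@[simp] theorem vx_fst {L : ℕ} (k : Fin 10) (i : Fin L) : (vx k i).1 = k := rfl
/-- Position index of `vx`. -/
@[simp] theorem vx_snd {L : ℕ} (k : Fin 10) (i : Fin L) : (vx k i).2 = i := rfl

/-- The frame of `𝒯_L`. -/
def frame (L : ℕ) : Finset (Sym2 (Vx L)) :=
  univ.image (fun i : Fin L => s(vx 0 i, vx 0 (succMod i))) ∪
  univ.image (fun i : Fin L => s(vx 1 i, vx 1 (succMod i))) ∪
  univ.image (fun i : Fin L => s(vx 0 i, vx 2 i)) ∪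
  univ.image (fun i : Fin L => s(vx 1 i, vx 6 i)) ∪
  univ.biUnion (fun i : Fin L =>
    ({s(vx 2 i, vx 4 i), s(vx 2 i, vx 5 i), s(vx 3 i, vx 4 i), s(vx 3 i, vx 5 i), s(vx 4 i, vx 5 i)} :
      Finset (Sym2 (Vx L)))) ∪
  univ.biUnion (fun i : Fin L =>
    ({s(vx 6 i, vx 8 i), s(vx 6 i, vx 9 i), s(vx 7 i, vx 8 i), s(vx 7 i, vx 9 i), s(vx 8 i, vx 9 i)} :
      Finset (Sym2 (Vx L))))

/-- The units of `𝒯_L`: `π_{(i,j)} = {bᵢcⱼ, b'ᵢc'ⱼ}`. -/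
def unit (L : ℕ) (u : Fin L × Fin L) : Finset (Sym2 (Vx L)) :=
  {s(vx 2 u.1, vx 6 u.2), s(vx 3 u.1, vx 7 u.2)}

/-- The fixed balanced cut `B₀` of `𝒯_L`. -/
def cut (L : ℕ) : Finset (Vx L) :=
  univ.filter fun v => v.1 = 1 ∨ v.1 = 3 ∨ v.1 = 4 ∨ v.1 = 7 ∨ v.1 = 8

/-- Membership in a unit: its two edges `b c` and `b' c'`. -/
theorem mem_unit {L : ℕ} {u : Fin L × Fin L} {e : Sym2 (Vx L)} :
    e ∈ unit L u ↔ e = s(vx 2 u.1, vx 6 u.2) ∨ e = s(vx 3 u.1, vx 7 u.2) := by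
  simp [unit]

/-- Membership in the cut `B₀` by block index. -/
theorem mem_cut {L : ℕ} {v : Vx L} : v ∈ cut L ↔ v.1 = 1 ∨ v.1 = 3 ∨ v.1 = 4 ∨ v.1 = 7 ∨ v.1 = 8 := by
  simp [cut]

/-- Every unit has exactly two edges. -/
theorem unit_card {L : ℕ} (u : Fin L × Fin L) : (unit L u).card = 2 := by
  rw [unit, card_pair_eq_two_iff]
  simp

/-- The cut `B₀` has `5L` vertices. -/
theorem cut_card (L : ℕ) : (cut L).card = 5 * L := by
  have h : cut L = (univ.filter fun k : Fin 10 => k = 1 ∨ k = 3 ∨ k = 4 ∨ k = 7 ∨ k = 8) ×ˢ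
      (univ : Finset (Fin L)) := by
    ext ⟨k, i⟩
    simp [cut]
  have h5 : (univ.filter fun k : Fin 10 => k = 1 ∨ k = 3 ∨ k = 4 ∨ k = 7 ∨ k = 8).card = 5 := by decide
  rw [h, card_product, h5, card_univ, Fintype.card_fin]

/-! ### D2 — `Γ − π_{(i₀,j₀)}` is 3-colourable -/

/-- Position of `i` on the cycle, counted from `i0`. -/
def pos {L : ℕ} (i0 i : Fin L) : ℕ := if i0.val ≤ i.val then i.val - i0.val else i.val + L - i0.val

/-- The explicit 3-colouring of `Γ − π_{u0}`. -/
def col {L : ℕ} (u0 : Fin L × Fin L) (v : Vx L) : Fin 3 :=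
  match v.1.val with
  | 0 => if v.2 = u0.1 then 0 else if pos u0.1 v.2 % 2 = 1 then 1 else 2
  | 1 => if v.2 = u0.2 then 2 else if pos u0.2 v.2 % 2 = 1 then 0 else 1
  | 2 => if v.2 = u0.1 then 1 else 0
  | 3 => if v.2 = u0.1 then 1 else 0
  | 4 => if v.2 = u0.1 then 0 else 1
  | 5 => 2
  | 6 => if v.2 = u0.2 then 1 else 2
  | 7 => if v.2 = u0.2 then 1 else 2
  | 8 => 0
  | _ => if v.2 = u0.2 then 2 else 1

section colfacts
variable {L : ℕ} (u0 : Fin L × Fin L) (i : Fin L)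

/-- The colouring `col` on block 0 (definitional unfolding). -/
theorem col0 : col u0 (vx 0 i) = if i = u0.1 then 0 else if pos u0.1 i % 2 = 1 then 1 else 2 := rfl
/-- The colouring `col` on block 1 (definitional unfolding). -/
theorem col1 : col u0 (vx 1 i) = if i = u0.2 then 2 else if pos u0.2 i % 2 = 1 then 0 else 1 := rfl
/-- The colouring `col` on block 2 (definitional unfolding). -/
theorem col2 : col u0 (vx 2 i) = if i = u0.1 then 1 else 0 := rfl
/-- The colouring `col` on block 3 (definitional unfolding). -/
theorem col3 : col u0 (vx 3 i) = if i = u0.1 then 1 else 0 := rfl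
/-- The colouring `col` on block 4 (definitional unfolding). -/
theorem col4 : col u0 (vx 4 i) = if i = u0.1 then 0 else 1 := rfl
/-- The colouring `col` on block 5 (definitional unfolding). -/
theorem col5 : col u0 (vx 5 i) = 2 := rfl
/-- The colouring `col` on block 6 (definitional unfolding). -/
theorem col6 : col u0 (vx 6 i) = if i = u0.2 then 1 else 2 := rfl
/-- The colouring `col` on block 7 (definitional unfolding). -/
theorem col7 : col u0 (vx 7 i) = if i = u0.2 then 1 else 2 := rfl
/-- The colouring `col` on block 8 (definitional unfolding). -/
theorem col8 : col u0 (vx 8 i) = 0 := rfl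
/-- The colouring `col` on block 9 (definitional unfolding). -/
theorem col9 : col u0 (vx 9 i) = if i = u0.2 then 2 else 1 := rfl

end colfacts

/-- The cycle colourings are proper (block `0`: colours `0 | 1,2 alternating`). -/
theorem col_cycleA {L : ℕ} (hL : Odd L) (h3 : 3 ≤ L) (u0 : Fin L × Fin L) (i : Fin L) :
    col u0 (vx 0 i) ≠ col u0 (vx 0 (succMod i)) := by
  obtain ⟨m, hm⟩ := hL
  rw [col0, col0]
  have hi := i.isLt
  have hi0 := u0.1.isLt
  rcases succMod_val_cases i with ⟨hs, hs'⟩ | ⟨hs, hs'⟩ <;>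
  · simp only [Fin.ext_iff, pos, hs]
    split_ifs <;> first | decide | (exfalso; omega)

/-- (block `1`: colours `2 | 0,1 alternating`). -/
theorem col_cycleD {L : ℕ} (hL : Odd L) (h3 : 3 ≤ L) (u0 : Fin L × Fin L) (i : Fin L) :
    col u0 (vx 1 i) ≠ col u0 (vx 1 (succMod i)) := by
  obtain ⟨m, hm⟩ := hL
  rw [col1, col1]
  have hi := i.isLt
  have hi0 := u0.2.isLt
  rcases succMod_val_cases i with ⟨hs, hs'⟩ | ⟨hs, hs'⟩ <;>
  · simp only [Fin.ext_iff, pos, hs]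
    split_ifs <;> first | decide | (exfalso; omega)

/-- `col` is proper on the matching edges `aᵢ bᵢ`. -/
theorem col_AB {L : ℕ} (u0 : Fin L × Fin L) (i : Fin L) : col u0 (vx 0 i) ≠ col u0 (vx 2 i) := by
  rw [col0, col2]
  split_ifs <;> decide

/-- `col` is proper on the matching edges `dⱼ cⱼ`. -/
theorem col_DC {L : ℕ} (u0 : Fin L × Fin L) (i : Fin L) : col u0 (vx 1 i) ≠ col u0 (vx 6 i) := by
  rw [col1, col6]
  split_ifs <;> decide

/-- `col` is proper on the diamond edge between blocks 2 and 4. -/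
theorem col_24 {L : ℕ} (u0 : Fin L × Fin L) (i : Fin L) : col u0 (vx 2 i) ≠ col u0 (vx 4 i) := by
  rw [col2, col4]; split_ifs <;> decide
/-- `col` is proper on the diamond edge between blocks 2 and 5. -/
theorem col_25 {L : ℕ} (u0 : Fin L × Fin L) (i : Fin L) : col u0 (vx 2 i) ≠ col u0 (vx 5 i) := by
  rw [col2, col5]; split_ifs <;> decide
/-- `col` is proper on the diamond edge between blocks 3 and 4. -/
theorem col_34 {L : ℕ} (u0 : Fin L × Fin L) (i : Fin L) : col u0 (vx 3 i) ≠ col u0 (vx 4 i) := by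
  rw [col3, col4]; split_ifs <;> decide
/-- `col` is proper on the diamond edge between blocks 3 and 5. -/
theorem col_35 {L : ℕ} (u0 : Fin L × Fin L) (i : Fin L) : col u0 (vx 3 i) ≠ col u0 (vx 5 i) := by
  rw [col3, col5]; split_ifs <;> decide
/-- `col` is proper on the diamond edge between blocks 4 and 5. -/
theorem col_45 {L : ℕ} (u0 : Fin L × Fin L) (i : Fin L) : col u0 (vx 4 i) ≠ col u0 (vx 5 i) := by
  rw [col4, col5]; split_ifs <;> decide
/-- `col` is proper on the diamond edge between blocks 6 and 8. -/
theorem col_68 {L : ℕ} (u0 : Fin L × Fin L) (i : Fin L) : col u0 (vx 6 i) ≠ col u0 (vx 8 i) := by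
  rw [col6, col8]; split_ifs <;> decide
/-- `col` is proper on the diamond edge between blocks 6 and 9. -/
theorem col_69 {L : ℕ} (u0 : Fin L × Fin L) (i : Fin L) : col u0 (vx 6 i) ≠ col u0 (vx 9 i) := by
  rw [col6, col9]; split_ifs <;> decide
/-- `col` is proper on the diamond edge between blocks 7 and 8. -/
theorem col_78 {L : ℕ} (u0 : Fin L × Fin L) (i : Fin L) : col u0 (vx 7 i) ≠ col u0 (vx 8 i) := by
  rw [col7, col8]; split_ifs <;> decide
/-- `col` is proper on the diamond edge between blocks 7 and 9. -/
theorem col_79 {L : ℕ} (u0 : Fin L × Fin L) (i : Fin L) : col u0 (vx 7 i) ≠ col u0 (vx 9 i) := by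
  rw [col7, col9]; split_ifs <;> decide
/-- `col` is proper on the diamond edge between blocks 8 and 9. -/
theorem col_89 {L : ℕ} (u0 : Fin L × Fin L) (i : Fin L) : col u0 (vx 8 i) ≠ col u0 (vx 9 i) := by
  rw [col8, col9]; split_ifs <;> decide

/-- The other units are properly coloured: `col bᵢ = col cⱼ` happens only at `(i,j) = u0`. -/
theorem col_unit {L : ℕ} (u0 u : Fin L × Fin L) (hu : u ≠ u0) : col u0 (vx 2 u.1) ≠ col u0 (vx 6 u.2) := by
  rw [col2, col6]
  split_ifs with h1 h2 <;> first | decide | exact (hu (Prod.ext h1 h2)).elim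

/-- `col` is proper on the second edge `b'ᵢ c'ⱼ` of every unit other than `u0`. -/
theorem col_unit' {L : ℕ} (u0 u : Fin L × Fin L) (hu : u ≠ u0) : col u0 (vx 3 u.1) ≠ col u0 (vx 7 u.2) := by
  rw [col3, col7]
  split_ifs with h1 h2 <;> first | decide | exact (hu (Prod.ext h1 h2)).elim

/-- Transfer of "endpoints get different colours" along an equation of unordered pairs. -/
theorem ne_of_edge_eq {L : ℕ} {κ : Vx L → Fin 3} {a b v w : Vx L} (h : s(a, b) = s(v, w)) (hab : κ a ≠ κ b) :
    κ v ≠ κ w := by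
  rcases Sym2.eq_iff.1 h with ⟨rfl, rfl⟩ | ⟨rfl, rfl⟩
  · exact hab
  · exact hab.symm

/-- Every edge of `Γ − π_{u0}` is properly coloured by `col u0`. -/
theorem col_proper {L : ℕ} (hL : Odd L) (h3 : 3 ≤ L) (u0 : Fin L × Fin L) (v w : Vx L)
    (h : s(v, w) ∈ gammaMinus (frame L) (unit L) u0) : col u0 v ≠ col u0 w := by
  rw [mem_gammaMinus] at h
  rcases h with h | ⟨u, hu, h⟩
  · simp only [frame, mem_union, mem_image, mem_biUnion, mem_univ, true_and, mem_insert, mem_singleton] at h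
    rcases h with ((((⟨i, h⟩ | ⟨i, h⟩) | ⟨i, h⟩) | ⟨i, h⟩) | ⟨i, h | h | h | h | h⟩) | ⟨i, h | h | h | h | h⟩
    · exact ne_of_edge_eq h (col_cycleA hL h3 u0 i)
    · exact ne_of_edge_eq h (col_cycleD hL h3 u0 i)
    · exact ne_of_edge_eq h (col_AB u0 i)
    · exact ne_of_edge_eq h (col_DC u0 i)
    · exact ne_of_edge_eq h.symm (col_24 u0 i)
    · exact ne_of_edge_eq h.symm (col_25 u0 i)
    · exact ne_of_edge_eq h.symm (col_34 u0 i)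
    · exact ne_of_edge_eq h.symm (col_35 u0 i)
    · exact ne_of_edge_eq h.symm (col_45 u0 i)
    · exact ne_of_edge_eq h.symm (col_68 u0 i)
    · exact ne_of_edge_eq h.symm (col_69 u0 i)
    · exact ne_of_edge_eq h.symm (col_78 u0 i)
    · exact ne_of_edge_eq h.symm (col_79 u0 i)
    · exact ne_of_edge_eq h.symm (col_89 u0 i)
  · rw [mem_unit] at h
    rcases h with h | h
    · exact ne_of_edge_eq h.symm (col_unit u0 u hu)
    · exact ne_of_edge_eq h.symm (col_unit' u0 u hu)

/-- **D2 for `𝒯_L`**. -/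
theorem toft_D2 {L : ℕ} (hL : Odd L) (h3 : 3 ≤ L) (u0 : Fin L × Fin L) :
    (SimpleGraph.fromEdgeSet (↑(gammaMinus (frame L) (unit L) u0) : Set (Sym2 (Vx L)))).Colorable 3 := by
  refine ⟨SimpleGraph.Coloring.mk (col u0) ?_⟩
  intro v w hadj
  rw [SimpleGraph.fromEdgeSet_adj, Finset.mem_coe] at hadj
  exact col_proper hL h3 u0 v w hadj.1

end Summit.PneNP.PneNP.Theorems.AeaCutRectanglesFixedCutFooling
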